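import Summits.BirchSwinnertonDyer.BirchSwinnertonDyer.Theses.TameQuarticManinParity
import HarnessLib

/-!
# Route `TameQuarticManinParity`, LINE 23 (bsd-idea-3 g8), glue G23
# `TprimeIrrTwistLatticeOrientationOfSerreWeight` (stmt-BirchSwinnertonDyer-28284) — PROVED BY NAME

Cell `pub/bsd-wall`, D-0145 line `route-BirchSwinnertonDyer-TeichmullerTwistDescent`, seat `bsd-line-ttd-p1` g10,
working the planner-of-record's TQMP LINE 23. BSD is NOT proved by this; Manin's conjecture is not proved by this;
W23b (`TprimeIrrKodairaThreeSerreWeightSix`, stmt-28281) and B23 (`TprimeIrrOrientationOfSerreWeightSix`,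
stmt-28282) stay OPEN here, and so does the orientation O22 (`TprimeIrrTwistLatticeOrientation`, stmt-28139). This
file closes ONLY the glue: O22 ⟸ W23b ∧ B23.

## Statement (verbatim the route decl)

`TprimeIrrKodairaThreeSerreWeightSix → TprimeIrrOrientationOfSerreWeightSix → TprimeIrrTwistLatticeOrientation`.

## Proof

Modus ponens: B23's Serre-weight hypothesis at a Kodaira-III row `W` is W23b's conclusion at `W`, quantified over the
same framed models `ρ`, coefficient fields `k`, embeddings `j`, local restriction data `loc` and residue embeddings
`ι`. Design: theorems only; no definition, no named fact, no `sorry`; axioms `propext`, `Classical.choice`,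
`Quot.sound`.
-/

set_option autoImplicit false
-- D-0017: single-problem summit, so `Summit.BirchSwinnertonDyer.BirchSwinnertonDyer.…` repeats a namespace BY DESIGN.
set_option linter.dupNamespace false

namespace Summit.BirchSwinnertonDyer.BirchSwinnertonDyer.Theorems.TameQuarticManinParity

open Summit.BirchSwinnertonDyer.BirchSwinnertonDyer.Theses.TameQuarticManinParity

/-- **Glue G23** (stmt-BirchSwinnertonDyer-28284), by name: W23b (Serre weight `6` on the Kodaira-III rows of the
irreducible tame quartic class at `3`) ∧ B23 (weight `6` forces the orientation inclusion
`Λ(D.f) ⊆ g(χ₋₃)·Λ(D.f ⊗ χ₋₃)`) ⟹ O22 `TprimeIrrTwistLatticeOrientation`. Pure logic. -/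
theorem tprimeIrrTwistLatticeOrientationOfSerreWeight_proof : TprimeIrrTwistLatticeOrientationOfSerreWeight := by
  unfold TprimeIrrTwistLatticeOrientationOfSerreWeight
  intro hW hB W _ _ _ hcm hadd ht hirr h3 D h9 χ hχ hprim z hz
  exact hB W hcm hadd ht hirr h3 (fun ρ hρ k _ _ _ _ _ j loc ι => hW W hadd ht hirr h3 ρ hρ k j loc ι)
    D h9 χ hχ hprim z hz

end Summit.BirchSwinnertonDyer.BirchSwinnertonDyer.Theorems.TameQuarticManinParity
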